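import Summits.BirchSwinnertonDyer.BirchSwinnertonDyer.Theorems.EisensteinDepletionAtTwoStarOptBNSFTwoIsogenyStep
import Summits.BirchSwinnertonDyer.BirchSwinnertonDyer.Theorems.EisensteinDepletionAtTwoStarOptBNSFTwoAdicDictionary
import Summits.BirchSwinnertonDyer.BirchSwinnertonDyer.Theorems.EisensteinDepletionAtTwoStarOptBTwoTorsionOfIsogenous
import Summits.BirchSwinnertonDyer.BirchSwinnertonDyer.Theorems.ByReductionTypeAtTwoOrdIsogenyRescale
import Literature.NumberTheory.EllipticCurves.IsogenyDegreeOneProofs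
import Literature.NumberTheory.EllipticCurves.IsogenySeparableFactorProofs
import Literature.NumberTheory.EllipticCurves.IsogenyXRationalFunctionProofs
import Literature.NumberTheory.EllipticCurves.IsogenyFactorProofs
import HarnessLib

/-!
# Stub `stub_twoPowerWalk` of line `nsf` on the crux `StarOptBNSF` (item stmt-BirchSwinnertonDyer-27047) — PROVED:
# the h-invariant walk along a `2`-power isogeny

Line `nsf` (planner bsd-rank2-p2 GEN 31/32, skeleton `Cruxes/StarOptBNSF/Lines/nsf.lean`, v4 registered 2026-08-28T11:44Z):
`StarOptBNSF ⇐ stub_thmAShadow ∧ stub_oddIso{Unique,TwoAdic,Arch} ∧ stub_twoPowerWalk` (composition `StarOptBNSF_of`).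
THIS FILE closes the registered stub

  `stub_twoPowerWalk : ∀ W (habitat: good ordinary at 2, unique rational 2-torsion point x of type A xor B) V (globally
   minimal) (φ : Isogeny W V), (∃ k, φ.degree = 2^k) → (V has no rational 2-torsion point ramified at 2) →
   ∃ x₀, HasRationalTwoTorsionX V x₀ ∧ TwoTorsionOdd V x₀ ∧ ¬ TwoTorsionRamifiedAtTwo x₀`

— THE WALK (memo HOME/p2/g29/OPTB-VIA-SIGMA.md §6, lead star-p1 GEN 6 by-name map §C.3).  Write `φ = λ ∘ [2^j]` with
`W[2] ⊄ ker λ` (`Isogeny.exists_eq_comp_nsmul_of_geomTorsion_le_ker_holds'`, AEC III.4.11); `ker λ` is a `2`-group.  Walk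
from `W` towards `V` one rational `2`-isogeny at a time (`Walk.twoIsogenyStep`: explicit Silverman `2`-isogeny onto a global
minimal model, kernel `{O, S}` with `S` the UNIQUE point of order `2` in `ker λ`, rational by Galois stability; factor
`λ = λ₁ ∘ π` by AEC III.4.11 `Isogeny.exists_eq_comp_of_ker_le`), carrying a rational point `T = (t, y)` of order `2` with
`λ T ≠ O` and the INVARIANT «`t` is ramified at `2` OR odd» (never «neither»): at a vertex with the two rational points
`T ≠ S`, `S` is not «both» (two distinct rational `2`-torsion abscissae are not both ramified —
`TwoAdic.not_twoTorsionRamifiedAtTwo_and_rat` — nor both the least root), so by the FLIP LAWS (Greenberg 1999 §5,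
`Greenberg1999.ramified_odd_dual_of_twoIsogeny_of_goodOrd_or_mult`) the dual point `S₁ = π T` is again «ramified or odd»;
the exponent of `ker λ` drops by one.  At the start `T = (x, ·)` is of type A or B; if `λ T = O` the first edge goes
through `T` itself (type A/B is not «both») and `T₁ = π P₀` for `P₀ ∈ W[2] ∖ ker λ`.  At the end `ker λ = O`, so `λ` has
degree `1` and is a CHANGE OF VARIABLES `V = C • E` (`Isogeny.exists_variableChange_eq_of_degree_eq_one`, AEC II.2.4.1) with
`u = ±1`, `r ∈ ℤ` between globally minimal models (`isGloballyMinimal_unique_holds`), which preserves both type bits; `V` has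
no ramified rational point, so `T` is odd, and its image is the sought odd étale rational `2`-torsion point of `V`.

HONEST FRAMING: stub 5 of line nsf (size L, bookkeeping); the research stub `stub_thmAShadow` and the odd-isogeny stubs are
untouched; nothing here proves `StarOptBNSF`, E1M_NSF or BSD.  Fact-free (standard axioms).

References: J. H. Silverman, *The Arithmetic of Elliptic Curves*, 2nd ed. (2009), II.2.4.1, III.4.5, III.4.11, VII.1.3, VIII.8.3
[SilvermanAEC2009]; R. Greenberg, LNM 1716 (1999), §5 [GreenbergLNM1716].
-/

set_option linter.dupNamespace false
set_option autoImplicit false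

noncomputable section

open scoped Classical

open WeierstrassCurve Literature.NumberTheory.EllipticCurves Literature.NumberTheory.EllipticCurves.Greenberg1999

namespace Summit.BirchSwinnertonDyer.BirchSwinnertonDyer.Theorems.DepletionAtTwo.Walk

/-! ### §1 Kernel bookkeeping -/

section Kernel

variable {W V : WeierstrassCurve ℚ}

/-- An isogeny of degree `2^k` has `2^k`-torsion kernel (Lagrange). [folklore] -/
theorem twoPow_nsmul_eq_zero_of_degree (φ : Isogeny W V) {k : ℕ} (hk : φ.degree = 2 ^ k) (P : W.geomPoints)
    (hP : φ P = 0) : (2 ^ k : ℕ) • P = 0 := by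
  have hP' : P ∈ φ.toAddMonoidHom.ker := (AddMonoidHom.mem_ker).mpr hP
  have h0 := congrArg Subtype.val (card_nsmul_eq_zero' (x := (⟨P, hP'⟩ : φ.toAddMonoidHom.ker)))
  simp only [AddSubgroupClass.coe_nsmul, ZeroMemClass.coe_zero] at h0
  unfold Isogeny.degree at hk
  rwa [hk] at h0

/-- **Factoring out the scalar part**: every isogeny `φ : W → V` of elliptic curves over `ℚ` is `λ ∘ [2^j]` for an
isogeny `λ` whose kernel does not contain `W[2]` (take `j` maximal with `W[2^j] ⊆ ker φ`; AEC III.4.11 for `[m]`, tree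
`Isogeny.exists_eq_comp_nsmul_of_geomTorsion_le_ker_holds'`). [cite: SilvermanAEC2009, Cor. III.4.11 and Cor. III.6.4(b)] -/
theorem exists_eq_comp_twoPow_nsmul [W.IsElliptic] [V.IsElliptic] (φ : Isogeny W V) :
    ∃ (j : ℕ) (lam : Isogeny W V), (∀ P, φ P = lam ((2 ^ j : ℕ) • P)) ∧
      ∃ P₀ : W.geomPoints, P₀ + P₀ = 0 ∧ lam P₀ ≠ 0 := by
  -- adapted from `DepletionAtTwo.exists_fixed_twoTorsion_of_isogeny`
  let A : ℕ → Prop := fun j ↦ ∀ P ∈ geomTorsion W ((2 ^ j : ℕ) : ℤ), φ P = 0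
  have hA0 : A 0 := by
    intro P hP
    rw [AddSubgroup.torsionBy.nsmul_iff, pow_zero, one_nsmul] at hP
    rw [hP, map_zero]
  obtain ⟨j, hj, hj'⟩ : ∃ j, A j ∧ ¬ A (j + 1) := by
    by_contra hcon
    push Not at hcon
    have hall : ∀ j, A j := fun j ↦ Nat.rec hA0 (fun k hk ↦ hcon k hk) j
    have hle : ∀ j, 4 ^ j ≤ Nat.card (φ.toAddMonoidHom.ker) := by
      intro j
      have hne : ((2 ^ j : ℕ) : AlgebraicClosure ℚ) ≠ 0 :=
        Nat.cast_ne_zero.mpr (pow_ne_zero j two_ne_zero)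
      have h1 : Nat.card (geomTorsion W ((2 ^ j : ℕ) : ℤ)) = (2 ^ j) ^ 2 :=
        card_torsionPoints_eq_sq_holds W (AlgebraicClosure ℚ) hne
      have h2 : Nat.card (geomTorsion W ((2 ^ j : ℕ) : ℤ)) ≤ Nat.card (φ.toAddMonoidHom.ker) :=
        Nat.card_mono φ.finite_ker fun P hP ↦ (AddMonoidHom.mem_ker).mpr (hall j P hP)
      calc 4 ^ j = (2 ^ j) ^ 2 := by rw [← pow_mul, mul_comm, pow_mul]; norm_num
        _ ≤ Nat.card (φ.toAddMonoidHom.ker) := h1 ▸ h2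
    exact absurd (hle _) (not_le.mpr (Nat.lt_pow_self (by norm_num)))
  have hne : ((2 ^ j : ℕ) : ℚ) ≠ 0 := Nat.cast_ne_zero.mpr (pow_ne_zero j two_ne_zero)
  obtain ⟨lam, hlam⟩ := Isogeny.exists_eq_comp_nsmul_of_geomTorsion_le_ker_holds' W V hne φ hj
  obtain ⟨P₁, hP₁, hP₁φ⟩ : ∃ P₁, P₁ ∈ geomTorsion W ((2 ^ (j + 1) : ℕ) : ℤ) ∧ φ P₁ ≠ 0 := by
    by_contra h
    push Not at h
    exact hj' h
  refine ⟨j, lam, hlam, (2 ^ j : ℕ) • P₁, ?_, ?_⟩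
  · rw [AddSubgroup.torsionBy.nsmul_iff, pow_succ, mul_nsmul, two_nsmul] at hP₁
    exact hP₁
  · rw [← hlam]; exact hP₁φ

/-- The four elements of `W[2]` relative to two distinct nonzero points `S ≠ T` of order `2`: a point `Q` of order
dividing `2` with `λ Q = O`, where `λ S = O ≠ λ T`, is `O` or `S`. [cite: SilvermanAEC2009, Cor. III.6.4(b)] -/
theorem eq_zero_or_eq_of_ker [W.IsElliptic] (lam : Isogeny W V) {S T Q : W.geomPoints} (hS : S + S = 0) (hT : T + T = 0)
    (hQ : Q + Q = 0) (hS0 : S ≠ 0) (hT0 : T ≠ 0) (hlamS : lam S = 0) (hlamT : lam T ≠ 0) (hlamQ : lam Q = 0) :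
    Q = 0 ∨ Q = S := by
  have hST : S ≠ T := fun h ↦ hlamT (h ▸ hlamS)
  rcases DepletionAtTwo.twoTorsion_cases W hT hS hQ hT0 hS0 hST with h | h | h | h
  · exact Or.inl h
  · exact absurd hlamQ (h ▸ hlamT)
  · exact Or.inr h
  · refine absurd hlamQ ?_
    rw [h, map_add, hlamS, zero_add]
    exact hlamT

end Kernel

/-! ### §2 The base of the walk: degree one -/

section Base

/-- `v₂(t + m) < 0 ↔ v₂(t) < 0` for an integer `m`. [folklore] -/
theorem padicValRat_add_intCast_neg_iff (t : ℚ) (m : ℤ) :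
    padicValRat 2 (t + m) < 0 ↔ padicValRat 2 t < 0 := by
  have key : ∀ (q : ℚ) (n : ℤ), padicValRat 2 q < 0 → padicValRat 2 (q + n) < 0 := by
    intro q n hq
    by_cases hn : n = 0
    · simpa [hn] using hq
    have hnv : 0 ≤ padicValRat 2 (n : ℚ) := by
      rw [padicValRat.of_int]; exact_mod_cast Nat.zero_le _
    have hq0 : q ≠ 0 := by rintro rfl; simp at hq
    have hqn : q + n ≠ 0 := by
      intro h
      have : q = -(n : ℚ) := by linear_combination h
      rw [this, padicValRat.neg] at hq
      exact absurd hnv (not_le.mpr hq)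
    have hneq : padicValRat 2 q ≠ padicValRat 2 (n : ℚ) := fun h ↦ by rw [h] at hq; exact absurd hnv (not_le.mpr hq)
    rw [padicValRat.add_eq_min hqn hq0 (by exact_mod_cast hn) hneq]
    exact lt_of_le_of_lt (min_le_left _ _) hq
  refine ⟨fun h ↦ ?_, key t m⟩
  have := key (t + m) (-m) h
  simpa using this

variable {E V : WeierstrassCurve ℚ} [E.IsElliptic] [E.IsGloballyMinimal] [V.IsElliptic] [V.IsGloballyMinimal]

/-- **Base of the walk.** An isogeny `λ : E → V` of globally minimal elliptic curves with trivial kernel is a change of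
variables `(±1, r, s, t)` with `r ∈ ℤ` (tree: `Isogeny.exists_variableChange_eq_of_degree_eq_one`, AEC II.2.4.1, and
`isGloballyMinimal_unique_holds`, AEC VII.1.3), so a rational point `(t, y)` of order `2` of `E` which is ramified at `2`
or odd gives the rational `2`-torsion abscissa `t − r` of `V` with the same bits; if `V` has no ramified rational point it
is odd and étale. [cite: SilvermanAEC2009, II.2.4.1 and Prop. VII.1.3(b)] -/
theorem walk_base (lam : Isogeny E V) (hker : ∀ P, lam P = 0 → P = 0) {t : ℚ} (ht : HasRationalTwoTorsionX E t)
    (hbits : TwoTorsionRamifiedAtTwo t ∨ TwoTorsionOdd E t)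
    (hV : ¬ ∃ x₀ : ℚ, HasRationalTwoTorsionX V x₀ ∧ TwoTorsionRamifiedAtTwo x₀) :
    ∃ x₀ : ℚ, HasRationalTwoTorsionX V x₀ ∧ TwoTorsionOdd V x₀ ∧ ¬ TwoTorsionRamifiedAtTwo x₀ := by
  have hdeg : lam.degree = 1 := by
    unfold Isogeny.degree
    have hbot : lam.toAddMonoidHom.ker = ⊥ := (AddMonoidHom.ker_eq_bot_iff _).mpr fun P Q h ↦ by
      have h0 : lam (P - Q) = 0 := by rw [map_sub]; exact sub_eq_zero.mpr h
      exact sub_eq_zero.mp (hker _ h0)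
    rw [hbot, AddSubgroup.card_bot]
  obtain ⟨C, hC⟩ := lam.exists_variableChange_eq_of_degree_eq_one hdeg
  subst hC
  obtain ⟨hu, r, s₀, t₀, hr, -, -⟩ := isGloballyMinimal_unique_holds E C
  have hu2 : ((C.u⁻¹ : ℚˣ) : ℚ) ^ 2 = 1 := by
    rcases hu with h | h <;> simp [h]
  have hx₀ : C.toX t = t + ((-r : ℤ) : ℚ) := by
    rw [VariableChange.toX_def, hu2, one_mul, hr]; push_cast; ring
  have hrat : HasRationalTwoTorsionX (C • E) (C.toX t) := PrimeConductorTwoTorsion.hasRationalTwoTorsionX_smul E C ht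
  have hnot : ¬ TwoTorsionRamifiedAtTwo (C.toX t) := fun h ↦ hV ⟨_, hrat, h⟩
  refine ⟨C.toX t, hrat, ?_, hnot⟩
  have hodd : TwoTorsionOdd E t := by
    rcases hbits with h | h
    · exfalso
      apply hnot
      rw [TwoTorsionRamifiedAtTwo, hx₀, padicValRat_add_intCast_neg_iff]
      exact h
    · exact h
  rw [twoTorsionOdd_smul_iff, ← VariableChange.ofX_def, VariableChange.ofX_toX]
  exact hodd

end Base

/-! ### §3 The walk -/

section Walk

/-- **The inductive walk.**  For globally minimal elliptic `E` (good ordinary at `2`) and `V` over `ℚ`, an isogeny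
`λ : E → V` whose kernel is killed by `2^k`, and a rational point `T = (t, y)` of order `2` on `E` with `λ T ≠ O` whose
abscissa is ramified at `2` OR odd: if `V` has no rational `2`-torsion abscissa ramified at `2`, then `V` has a rational
`2`-torsion abscissa that is odd and not ramified.  Induction on `k`: at `k = 0` this is `walk_base`; otherwise either
`2^(k-1)` already kills `ker λ`, or `S = 2^(k-1) P ∈ ker λ` is a point of order `2`, rational (the only such point in
`ker λ`), distinct from `T` and not «ramified ∧ odd» (vertex laws), and one `twoIsogenyStep` through `S` flips its bits onto
the dual point `π T`, through which `λ` factors with kernel killed by `2^(k-1)`.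
[cite: GreenbergLNM1716, §5; SilvermanAEC2009, III.4.11] -/
theorem walk_aux (k : ℕ) :
    ∀ (E : WeierstrassCurve ℚ) [E.IsElliptic] [E.IsGloballyMinimal] (V : WeierstrassCurve ℚ) [V.IsElliptic]
      [V.IsGloballyMinimal] (lam : Isogeny E V) (t y : ℚ) (hP : E.toAffine.Nonsingular t y),
      2 * y + E.a₁ * t + E.a₃ = 0 → IsOrdinaryAt E 2 →
      (∀ P : E.geomPoints, lam P = 0 → (2 ^ k : ℕ) • P = 0) →
      lam (toGeomPoints E (Affine.Point.some t y hP)) ≠ 0 →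
      (TwoTorsionRamifiedAtTwo t ∨ TwoTorsionOdd E t) →
      (¬ ∃ x₀ : ℚ, HasRationalTwoTorsionX V x₀ ∧ TwoTorsionRamifiedAtTwo x₀) →
      ∃ x₀ : ℚ, HasRationalTwoTorsionX V x₀ ∧ TwoTorsionOdd V x₀ ∧ ¬ TwoTorsionRamifiedAtTwo x₀ := by
  induction k with
  | zero =>
    intro E _ _ V _ _ lam t y hP hy hord hk hT hbits hV
    exact walk_base lam (fun P h ↦ by simpa using hk P h) (hasRationalTwoTorsionX_of_nonsingular hP hy) hbits hV
  | succ k ih =>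
    intro E _ _ V _ _ lam t y hP hy hord hk hT hbits hV
    by_cases hsmall : ∀ P : E.geomPoints, lam P = 0 → (2 ^ k : ℕ) • P = 0
    · exact ih E V lam t y hP hy hord hsmall hT hbits hV
    push Not at hsmall
    obtain ⟨P, hPker, hPk⟩ := hsmall
    -- the point `S = 2^k P` of order `2` in `ker λ`
    set S : E.geomPoints := (2 ^ k : ℕ) • P with hSdef
    have hS0 : S ≠ 0 := hPk
    have hS2 : S + S = 0 := by
      rw [hSdef, ← two_nsmul, ← mul_nsmul, ← pow_succ]
      exact hk P hPker
    have hlamS : lam S = 0 := by rw [hSdef, map_nsmul, hPker, nsmul_zero]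
    set T : E.geomPoints := toGeomPoints E (Affine.Point.some t y hP) with hTdef
    obtain ⟨hT0, hT2, hTfix⟩ := toGeomPoints_two_torsion hP hy
    have hSfix : ∀ σ : Field.absoluteGaloisGroup ℚ, σ • S = S := by
      intro σ
      have hσ2 : σ • S + σ • S = 0 := by rw [← smul_add, hS2, smul_zero]
      have hσlam : lam (σ • S) = 0 := by rw [lam.map_smul, hlamS, smul_zero]
      rcases eq_zero_or_eq_of_ker lam hS2 hT2 hσ2 hS0 hT0 hlamS hT hσlam with h | h
      · exact absurd (MulAction.injective σ (h.trans (smul_zero σ).symm)) hS0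
      · exact h
    -- `S` is rational: `S = (s, y_s)`
    obtain ⟨s, ys, hPs, hSeq, hys⟩ := exists_eq_toGeomPoints_of_two_torsion (E := E) hS0 hS2 hSfix
    have hs : HasRationalTwoTorsionX E s := hasRationalTwoTorsionX_of_nonsingular hPs hys
    have ht : HasRationalTwoTorsionX E t := hasRationalTwoTorsionX_of_nonsingular hP hy
    have hst : s ≠ t := by
      intro h
      have : S = T := by rw [hSeq, hTdef, toGeomPoints_some_eq_iff hPs hP hys hy]; exact h
      exact hT (this ▸ hlamS)
    -- `S` is not «ramified ∧ odd»
    have hSnotAB : ¬ (TwoTorsionRamifiedAtTwo s ∧ TwoTorsionOdd E s) := by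
      rintro ⟨hsr, hso⟩
      rcases hbits with htr | hto
      · exact TwoAdic.not_twoTorsionRamifiedAtTwo_and_rat E hord.1 ht hs hst.symm ⟨htr, hsr⟩
      · exact hst (eq_of_twoTorsionOdd_of_twoTorsionOdd hs ht hso hto)
    -- the step through `S`
    obtain ⟨E₁, hE₁, hE₁min, π, s₁, y₁, hP₁, hy₁, hkerπ, hdual, hedge⟩ := twoIsogenyStep E hPs hys
    have hord₁ : IsOrdinaryAt E₁ 2 := IsogenyMuShift.isOrdinaryAt_of_isIsogenous ⟨π⟩ hord
    obtain ⟨hR, hO⟩ := hedge (Or.inl hord) (Or.inl hord₁)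
    have hbits₁ : TwoTorsionRamifiedAtTwo s₁ ∨ TwoTorsionOdd E₁ s₁ := by
      by_contra hcon
      push Not at hcon
      exact hSnotAB ⟨hR.mpr hcon.1, hO.mpr hcon.2⟩
    -- factor `λ = λ₁ ∘ π`
    have hsep : π.deg ≤ Nat.card π.toAddMonoidHom.ker := le_of_eq (Isogeny.degree_eq_deg π).symm
    have hkerle : ∀ Q : E.geomPoints, π Q = 0 → lam Q = 0 := by
      intro Q hQ
      rcases (hkerπ Q).mp hQ with h | h
      · rw [h, map_zero]
      · rw [h, ← hSeq, hlamS]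
    obtain ⟨lam₁, hlam₁⟩ := π.exists_eq_comp_of_ker_le lam hsep hkerle
    -- the new point `T₁ = π T`
    have hTS : T ≠ toGeomPoints E (Affine.Point.some s ys hPs) := fun h ↦ hT (by rw [hTdef] at h ⊢; rw [h, ← hSeq, hlamS])
    have hπT : π T = toGeomPoints E₁ (Affine.Point.some s₁ y₁ hP₁) := hdual T hT0 hT2 hTS
    have hT₁ : lam₁ (toGeomPoints E₁ (Affine.Point.some s₁ y₁ hP₁)) ≠ 0 := by
      rw [← hπT, ← hlam₁]; exact hT
    -- `2^k` kills `ker λ₁`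
    have hk₁ : ∀ Q : E₁.geomPoints, lam₁ Q = 0 → (2 ^ k : ℕ) • Q = 0 := by
      intro Q hQ
      obtain ⟨R, rfl⟩ := π.surjective Q
      have hR : lam R = 0 := by rw [hlam₁]; exact hQ
      have hR2 : (2 ^ k : ℕ) • R + (2 ^ k : ℕ) • R = 0 := by
        rw [← two_nsmul, ← mul_nsmul, ← pow_succ]
        exact hk R hR
      have hRlam : lam ((2 ^ k : ℕ) • R) = 0 := by rw [map_nsmul, hR, nsmul_zero]
      rw [← map_nsmul]
      rcases eq_zero_or_eq_of_ker lam hS2 hT2 hR2 hS0 hT0 hlamS hT hRlam with h | h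
      · rw [h, map_zero]
      · rw [h]
        exact (hkerπ S).mpr (Or.inr hSeq)
    haveI := hE₁
    haveI := hE₁min
    exact ih E₁ V lam₁ s₁ y₁ hP₁ hy₁ hord₁ hk₁ hT₁ hbits₁ hV

/-- **Registered stub `stub_twoPowerWalk` of line `nsf` (crux `StarOptBNSF`, stmt-BirchSwinnertonDyer-27047), VERBATIM.**
In the `2`-power isogeny class of a habitat curve `W` (good ordinary at `2`, exactly one rational `2`-torsion point, of
type A xor B), a globally minimal `V` reached by an isogeny of degree `2^k` and WITHOUT a ramified rational `2`-torsion point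
has a rational `2`-torsion point that is odd and étale.  (Factor `φ = λ ∘ [2^j]` with `W[2] ⊄ ker λ`; if `λ` does not kill
the habitat point run `walk_aux` from it; otherwise take one `twoIsogenyStep` through it first and run `walk_aux` from the
dual point `π P₀`, `P₀ ∈ W[2] ∖ ker λ`.) [cite: GreenbergLNM1716, §5; SilvermanAEC2009, III.4.11 and III.4.12] -/
theorem stub_twoPowerWalk :
    ∀ (W : WeierstrassCurve ℚ) [W.IsElliptic] [W.IsGloballyMinimal] (x : ℚ),
      IsOrdinaryAt W 2 → HasUniqueRationalTwoTorsionX W x →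
      ((TwoTorsionRamifiedAtTwo x ∧ ¬ TwoTorsionOdd W x) ∨
        (TwoTorsionOdd W x ∧ ¬ TwoTorsionRamifiedAtTwo x)) →
      ∀ (V : WeierstrassCurve ℚ) [V.IsElliptic] [V.IsGloballyMinimal] (φ : WeierstrassCurve.Isogeny W V),
        (∃ k : ℕ, φ.degree = 2 ^ k) →
        (¬ ∃ x₀ : ℚ, HasRationalTwoTorsionX V x₀ ∧ TwoTorsionRamifiedAtTwo x₀) →
        ∃ x₀ : ℚ, HasRationalTwoTorsionX V x₀ ∧ TwoTorsionOdd V x₀ ∧ ¬ TwoTorsionRamifiedAtTwo x₀ := by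
  intro W _ _ x hord hux htype V _ _ φ hk hV
  obtain ⟨k, hk⟩ := hk
  obtain ⟨y, hP, hy⟩ := exists_nonsingular_of_hasRationalTwoTorsionX W hux.1
  obtain ⟨hT0, hT2, hTfix⟩ := toGeomPoints_two_torsion hP hy
  set T : W.geomPoints := toGeomPoints W (Affine.Point.some x y hP) with hTdef
  have hbits : TwoTorsionRamifiedAtTwo x ∨ TwoTorsionOdd W x := by
    rcases htype with ⟨h, -⟩ | ⟨h, -⟩
    · exact Or.inl h
    · exact Or.inr h
  -- `φ = λ ∘ [2^j]`, `W[2] ⊄ ker λ`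
  obtain ⟨j, lam, hlam, P₀, hP₀2, hlamP₀⟩ := exists_eq_comp_twoPow_nsmul φ
  have hkφ := twoPow_nsmul_eq_zero_of_degree φ hk
  have hklam : ∀ Q : W.geomPoints, lam Q = 0 → (2 ^ k : ℕ) • Q = 0 := by
    intro Q hQ
    obtain ⟨R, hR⟩ := (Isogeny.nsmul W (2 ^ j) (pow_ne_zero j two_ne_zero)).surjective Q
    rw [Isogeny.nsmul_apply] at hR
    subst hR
    have hφR : φ R = 0 := by rw [hlam]; exact hQ
    rw [← mul_nsmul', mul_comm, mul_nsmul', hkφ R hφR, nsmul_zero]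
  by_cases hlamT : lam T = 0
  · -- first edge through the habitat point itself
    have hnotAB : ¬ (TwoTorsionRamifiedAtTwo x ∧ TwoTorsionOdd W x) := by
      rintro ⟨hr, ho⟩
      rcases htype with ⟨-, h⟩ | ⟨-, h⟩
      · exact h ho
      · exact h hr
    obtain ⟨E₁, hE₁, hE₁min, π, s₁, y₁, hP₁, hy₁, hkerπ, hdual, hedge⟩ := twoIsogenyStep W hP hy
    have hord₁ : IsOrdinaryAt E₁ 2 := IsogenyMuShift.isOrdinaryAt_of_isIsogenous ⟨π⟩ hord
    obtain ⟨hR, hO⟩ := hedge (Or.inl hord) (Or.inl hord₁)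
    have hbits₁ : TwoTorsionRamifiedAtTwo s₁ ∨ TwoTorsionOdd E₁ s₁ := by
      by_contra hcon
      push Not at hcon
      exact hnotAB ⟨hR.mpr hcon.1, hO.mpr hcon.2⟩
    have hsep : π.deg ≤ Nat.card π.toAddMonoidHom.ker := le_of_eq (Isogeny.degree_eq_deg π).symm
    have hkerle : ∀ Q : W.geomPoints, π Q = 0 → lam Q = 0 := by
      intro Q hQ
      rcases (hkerπ Q).mp hQ with h | h
      · rw [h, map_zero]
      · rw [h]; exact hlamT
    obtain ⟨lam₁, hlam₁⟩ := π.exists_eq_comp_of_ker_le lam hsep hkerle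
    have hP₀0 : P₀ ≠ 0 := fun h ↦ hlamP₀ (by rw [h, map_zero])
    have hP₀T : P₀ ≠ T := fun h ↦ hlamP₀ (by rw [h]; exact hlamT)
    have hπP₀ : π P₀ = toGeomPoints E₁ (Affine.Point.some s₁ y₁ hP₁) := hdual P₀ hP₀0 hP₀2 hP₀T
    have hT₁ : lam₁ (toGeomPoints E₁ (Affine.Point.some s₁ y₁ hP₁)) ≠ 0 := by
      rw [← hπP₀, ← hlam₁]; exact hlamP₀
    have hk₁ : ∀ Q : E₁.geomPoints, lam₁ Q = 0 → (2 ^ k : ℕ) • Q = 0 := by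
      intro Q hQ
      obtain ⟨R, rfl⟩ := π.surjective Q
      have hR : lam R = 0 := by rw [hlam₁]; exact hQ
      rw [← map_nsmul, hklam R hR, map_zero]
    haveI := hE₁
    haveI := hE₁min
    exact walk_aux k E₁ V lam₁ s₁ y₁ hP₁ hy₁ hord₁ hk₁ hT₁ hbits₁ hV
  · exact walk_aux k W V lam x y hP hy hord hklam hlamT hbits hV

end Walk

end Summit.BirchSwinnertonDyer.BirchSwinnertonDyer.Theorems.DepletionAtTwo.Walk

end
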